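import Summits.CriticalPhenomena.PercolationContinuityZ3.Theses.PercNearOneGluing
import Summits.CriticalPhenomena.PercolationContinuityZ3.Theorems.PercNearOneGluingAdditiveGluingGoodStepResidual
import Summits.CriticalPhenomena.PercolationContinuityZ3.Theorems.PercNearOneGluingAdditiveGluingGoodStep
import Summits.CriticalPhenomena.PercolationContinuityZ3.Theorems.PercNearOneGluingAdditiveGluingGoodBase
import Summits.CriticalPhenomena.PercolationContinuityZ3.Theorems.PercNearOneGluingAdditiveGluingLemma5AnyRelay

/-! # TTRL-lite variant V23024 of `AdditiveGluing` / `stub_goodStaysGoodBlock` (stmt-CriticalPhenomena-4576)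

Machine-generated helper (proved); move `lemma_proposal`, op `llm`: bridge: the conditioning event of `BHK2006_clusterConditionalPositiveAssociation` with X = ↑T is literally (⋃ v∈T, openConn a₀ v)ᶜ — needed to instantiate the named fact.
See docs/architecture/ttrl-lite.md. -/

namespace Summit.CriticalPhenomena.PercolationContinuityZ3.Theorems

open MeasureTheory Set
open Literature.Probability.LatticeModels (prodBernoulli)
open Literature.Probability.Percolation (BondConfig openConn openConnIn openGraph openCluster)
open Summit.CriticalPhenomena.PercolationContinuityZ3.Theorems

/-- TTRL-lite variant V23024 (lemma_proposal `llm`) of `stub_goodStaysGoodBlock` (stmt-CriticalPhenomena-4576); machine-found, kernel-checked. -/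
theorem stub_goodStaysGoodBlock_var23024 :
    ∀ (n : ℕ) (T : Finset (Fin n)) (a₀ : Fin n), {ω : BondConfig (Fin n) | ∀ x ∈ (↑T : Set (Fin n)), ¬ (openGraph ω).Reachable a₀ x} = (⋃ v ∈ T, openConn a₀ v)ᶜ := by
  intros
  aesop

end Summit.CriticalPhenomena.PercolationContinuityZ3.Theorems
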